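import Summits.NavierStokesRegularity.NavierStokesRegularity.Theorems.SoloRefuteLiuYong2026K41UpperFlow

/-!
# C138 `LiuYong2026` (γ), part 2/2: the Cesàro spectrum of the recurring 2-adic burst flow violates the K41
# upper bound — `not_Step3_K41_upper : ¬ Literature.Claims.NS.LiuYong2026.Step3_K41_upper`

first failing step = `Literature.Claims.NS.LiuYong2026.Step3_K41_upper` (print p.18), class = false lemma
(countermodel). Records-grade companion RULED (γ) 2026-08-27T07:47:20Z; the adjudicated token of row #119 stays
`Step3_K41` / `…Theorems.LiuYong2026.not_Step3_K41` (p511629) — this is the charity/erratum column («the one-sided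
face `Φ(k) ≤ C|k|^{-5/3}` that 引理H.1 p.57 L13 actually consumes is ALSO false in the print's forced class»), not a
re-key. Face = rev 3 p512649 l.713 (ns-claims-typist-7 g5), negated LITERALLY.
THE COMPUTATION (flow of part 1, `SoloRefuteLiuYong2026K41UpperFlow.lean`, at `ν = 1`): the mode energy is
`𝓔(k,t) = ψ(t−⌊t⌋)²/8 · [k = ±2^{v₂(⌊t⌋+1)} e₀]` (§6), so `∫ₙ^{n+1} 𝓔 = (c₀/8)·[hit]`, `c₀ = ∫₀¹ψ² ≥ 1/8` (§7); the
number of slots `n < N` with `v₂(n+1) = m` is `⌊N/2^m⌋ − ⌊N/2^{m+1}⌋ = N/2^{m+1} + O(1)` (§8); hence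
`T⁻¹∫₀ᵀ 𝓔(±2^m e₀, t) dt = c₀/(16·2^m) + O(1/T)` — GENUINE Cesàro limits, `HasCesaroSpectrum vel Φ` with
`Φ(±2^m e₀) = c₀/(16·2^m)` and `Φ = 0` elsewhere (§9); and `Φ(2^m e₀)·|2^m e₀|^{5/3} = (c₀/16)·2^{2m/3} → ∞`
contradicts `IsK41Upper Φ` (§10). The headline instantiates the face at `ν = 1`, `f = frc 1`, `u₀ = vel 0 = 0`,
`u = vel`, `Φ = Phi` with `isData_vel`, `isGlobalLerayHopf_vel`, `hasCesaroSpectrum_vel`.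
Author: ns-claims-refuter-7 g3 ((γ) builder); adopter ns-claims-refuter-5 g3; filer ns-claims-salvage-p5 g3.
WHAT THIS IS NOT: not a claim about NS regularity or blow-up; not a claim about any author beyond the typed locator.
-/

noncomputable section
set_option linter.dupNamespace false

open Set MeasureTheory Filter Topology intervalIntegral UnitAddTorus Finset Metric
open scoped ContDiff BigOperators

namespace Summit.NavierStokesRegularity.NavierStokesRegularity.Theorems.LiuYong2026.K41Upper
open Literature.Claims.NS.LiuYong2026
open Literature.Analysis Literature.Analysis.FluidPDE Literature.Analysis.FunctionSpaces
open Literature.Analysis.FunctionSpaces.Torus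

/-! ## 6. Mode energies of the witness -/
/-- Squared Fourier coefficients of the shear mode `m`: `1/4` at `± kv m`, zero elsewhere. -/
theorem norm_coeff_mode_sq (m : ℕ) (k : Z3) :
    ‖coeff (realTrigPoly {kv m} pol) k‖ ^ 2 = if k = kv m ∨ k = -kv m then 1 / 4 else 0 := by
  unfold coeff
  rw [mFourierCoeff_realTrigPoly_singleton]
  by_cases h1 : k = kv m
  · have h2 : k ≠ -kv m := h1 ▸ kv_ne_neg m m
    rw [if_pos h1, if_neg h2, if_pos (Or.inl h1), EuclideanSpace.conjVec_zero, add_zero, norm_smul,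
      norm_inv, norm_pol, Complex.norm_ofNat]
    norm_num
  · by_cases h2 : k = -kv m
    · rw [if_neg h1, if_pos h2, if_pos (Or.inr h2), zero_add, conjVec_pol, norm_smul, norm_inv,
        norm_pol, Complex.norm_ofNat]
      norm_num
    · rw [if_neg h1, if_neg h2, if_neg (not_or.2 ⟨h1, h2⟩), EuclideanSpace.conjVec_zero, add_zero,
        smul_zero, norm_zero]
      norm_num
/-- **Mode energies of the frozen flows**: `𝓔(k, U_n(τ)) = ψ(τ-n)²/8 · hit k n`. -/
theorem modeEnergy_U (n : ℕ) (τ : ℝ) (k : Z3) :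
    modeEnergy (U n τ) k = 1 / 8 * amp n τ ^ 2 * hit k n := by
  unfold modeEnergy hit
  have h : coeff (U n τ) k = ((amp n τ : ℝ) : ℂ) • coeff (realTrigPoly {kv (slotMode n)} pol) k := by
    unfold coeff U
    have hfun : (EuclideanSpace.complexify ∘ fun x : T3 =>
        amp n τ • realTrigPoly {kv (slotMode n)} pol x) =
        ((amp n τ : ℝ) : ℂ) • (EuclideanSpace.complexify ∘ realTrigPoly {kv (slotMode n)} pol) := by
      funext x
      simp only [Function.comp_apply, Pi.smul_apply, map_smul, Complex.coe_smul]
    rw [hfun, mFourierCoeff_const_smul]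
  rw [h, norm_smul, Complex.norm_real, Real.norm_eq_abs, mul_pow, sq_abs, norm_coeff_mode_sq]
  split_ifs <;> ring
/-- **Mode energies of the witness**: `𝓔(k, t) = ψ(t - ⌊t⌋₊)²/8 · hit k ⌊t⌋₊`. -/
theorem modeEnergy_vel (t : ℝ) (k : Z3) :
    modeEnergy (vel t) k = 1 / 8 * amp ⌊t⌋₊ t ^ 2 * hit k ⌊t⌋₊ :=
  modeEnergy_U ⌊t⌋₊ t k
/-- Uniform bound `‖𝓔(k,t)‖ ≤ 1/8`. -/
theorem norm_modeEnergy_vel_le (t : ℝ) (k : Z3) : ‖modeEnergy (vel t) k‖ ≤ 1 / 8 := by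
  rw [modeEnergy_vel, Real.norm_eq_abs,
    abs_of_nonneg (mul_nonneg (mul_nonneg (by norm_num) (sq_nonneg _)) (hit_nonneg _ _))]
  have h1 := amp_sq_le_one ⌊t⌋₊ t
  have h2 := hit_le_one k ⌊t⌋₊
  have h3 := hit_nonneg k ⌊t⌋₊
  nlinarith

/-! ## 7. Slot integrals -/
/-- The profile energy per burst `c₀ = ∫₀¹ ψ²`. -/
def c0 : ℝ := ∫ s in (0 : ℝ)..1, ψ s ^ 2
/-- `ψ²` is continuous. -/
theorem continuous_ψ_sq : Continuous fun s => ψ s ^ 2 := ψ_contDiff.continuous.pow 2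
/-- `c₀ ≥ 1/8 > 0` (ψ = 1 on `[7/16, 9/16]`). -/
theorem c0_pos : 0 < c0 := by
  have hi : ∀ a b : ℝ, IntervalIntegrable (fun s => ψ s ^ 2) volume a b := fun a b =>
    continuous_ψ_sq.intervalIntegrable a b
  have h1 : 0 ≤ ∫ s in (0 : ℝ)..(7 / 16), ψ s ^ 2 :=
    intervalIntegral.integral_nonneg (by norm_num) fun s _ => sq_nonneg _
  have h3 : 0 ≤ ∫ s in (9 / 16 : ℝ)..1, ψ s ^ 2 :=
    intervalIntegral.integral_nonneg (by norm_num) fun s _ => sq_nonneg _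
  have h2 : ∫ s in (7 / 16 : ℝ)..(9 / 16), ψ s ^ 2 = 1 / 8 := by
    rw [intervalIntegral.integral_congr (g := fun _ => (1 : ℝ)) ?_, intervalIntegral.integral_const,
      smul_eq_mul]
    · norm_num
    · intro s hs
      rw [Set.uIcc_of_le (by norm_num)] at hs
      show ψ s ^ 2 = 1
      rw [ψ_eq_one (abs_le.2 ⟨by linarith [hs.1], by linarith [hs.2]⟩), one_pow]
  have hc : c0 = (∫ s in (0 : ℝ)..(7 / 16), ψ s ^ 2) + (∫ s in (7 / 16 : ℝ)..(9 / 16), ψ s ^ 2) +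
      ∫ s in (9 / 16 : ℝ)..1, ψ s ^ 2 := by
    unfold c0
    rw [intervalIntegral.integral_add_adjacent_intervals (hi _ _) (hi _ _),
      intervalIntegral.integral_add_adjacent_intervals (hi _ _) (hi _ _)]
  linarith
/-- On a closed slot `[n, T]`, `T ≤ n + 1`, the mode energy is the frozen profile
(at `T = n + 1` both vanish since `ψ(0) = ψ(1) = 0`). -/
theorem modeEnergy_eqOn_slot (k : Z3) (n : ℕ) {T : ℝ} (hT : T ≤ n + 1) :
    EqOn (fun t => modeEnergy (vel t) k) (fun t => 1 / 8 * ψ (t - n) ^ 2 * hit k n) (Icc (n : ℝ) T) := by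
  intro t ht
  show modeEnergy (vel t) k = 1 / 8 * ψ (t - n) ^ 2 * hit k n
  rcases (ht.2.trans hT).lt_or_eq with hlt | heq
  · have hfl : ⌊t⌋₊ = n := (Nat.floor_eq_iff (le_trans n.cast_nonneg ht.1)).2 ⟨ht.1, hlt⟩
    rw [modeEnergy_vel, hfl]
    rfl
  · rw [modeEnergy_vel, heq]
    have hfl : ⌊(n : ℝ) + 1⌋₊ = n + 1 := by exact_mod_cast Nat.floor_natCast (R := ℝ) (n + 1)
    rw [hfl]
    have e1 : amp (n + 1) ((n : ℝ) + 1) = 0 := amp_eq_zero (by push_cast; norm_num)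
    have e2 : ψ ((n : ℝ) + 1 - n) = 0 := ψ_eq_zero (by norm_num)
    rw [e1, e2]
    simp
/-- Integrability on a slot `[n, T]`, `n ≤ T ≤ n + 1`. -/
theorem intervalIntegrable_slot (k : Z3) (n : ℕ) {T : ℝ} (hnT : (n : ℝ) ≤ T) (hT : T ≤ n + 1) :
    IntervalIntegrable (fun t => modeEnergy (vel t) k) volume n T := by
  have hc : ContinuousOn (fun t : ℝ => 1 / 8 * ψ (t - n) ^ 2 * hit k n) (uIcc (n : ℝ) T) :=
    ((continuous_const.mul ((ψ_contDiff.continuous.comp (continuous_id.sub continuous_const)).pow 2)).mul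
      continuous_const).continuousOn
  rw [Set.uIcc_of_le hnT] at hc
  have hc' : ContinuousOn (fun t => modeEnergy (vel t) k) (uIcc (n : ℝ) T) := by
    rw [Set.uIcc_of_le hnT]
    exact hc.congr (modeEnergy_eqOn_slot k n hT)
  exact hc'.intervalIntegrable
/-- **Slot integral**: `∫ₙ^{n+1} 𝓔(k,t) dt = (c₀/8) · hit k n`. -/
theorem integral_slot (k : Z3) (n : ℕ) :
    ∫ t in (n : ℝ)..(n + 1), modeEnergy (vel t) k = c0 / 8 * hit k n := by
  have hcongr : EqOn (fun t => modeEnergy (vel t) k) (fun t => 1 / 8 * ψ (t - n) ^ 2 * hit k n)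
      (uIcc (n : ℝ) (n + 1)) := by
    rw [Set.uIcc_of_le (by linarith)]
    exact modeEnergy_eqOn_slot k n le_rfl
  rw [intervalIntegral.integral_congr hcongr]
  have hf : (fun t : ℝ => 1 / 8 * ψ (t - n) ^ 2 * hit k n) =
      fun t => (1 / 8 * hit k n) * (fun s => ψ s ^ 2) (t - n) := by
    funext t
    ring
  rw [hf, intervalIntegral.integral_const_mul,
    intervalIntegral.integral_comp_sub_right (fun s => ψ s ^ 2) (n : ℝ)]
  simp only [sub_self, add_sub_cancel_left, c0]
  ring
/-- Integrability on `[0, N]`. -/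
theorem intervalIntegrable_upto (k : Z3) :
    ∀ N : ℕ, IntervalIntegrable (fun t => modeEnergy (vel t) k) volume 0 N
  | 0 => by simp
  | N + 1 => (intervalIntegrable_upto k N).trans (by
      push_cast
      exact intervalIntegrable_slot k N (by linarith) le_rfl)
/-- **Integral up to an integer time**: `∫₀ᴺ 𝓔(k,t) dt = (c₀/8) · #{n < N : hit}`. -/
theorem integral_upto (k : Z3) (N : ℕ) :
    ∫ t in (0 : ℝ)..N, modeEnergy (vel t) k = c0 / 8 * ∑ n ∈ Finset.range N, hit k n := by
  have h := intervalIntegral.sum_integral_adjacent_intervals (a := fun n : ℕ => (n : ℝ)) (n := N)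
    (f := fun t => modeEnergy (vel t) k) (μ := volume)
    fun n _ => by push_cast; exact intervalIntegrable_slot k n (by linarith) le_rfl
  rw [Nat.cast_zero] at h
  rw [← h, Finset.mul_sum]
  refine Finset.sum_congr rfl fun n _ => ?_
  push_cast
  exact integral_slot k n

/-! ## 8. Counting the bursts: `#{n < N : v₂(n+1) = m} = ⌊N/2^m⌋ − ⌊N/2^{m+1}⌋` -/
/-- At a burst frequency `k = ± kv m`, `hit k n = [slotMode n = m]`. -/
theorem hit_of_mode (m n : ℕ) {k : Z3} (hk : k = kv m ∨ k = -kv m) :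
    hit k n = if slotMode n = m then 1 else 0 := by
  unfold hit
  by_cases h : slotMode n = m
  · subst h
    rw [if_pos hk, if_pos rfl]
  · rw [if_neg, if_neg h]
    rcases hk with rfl | rfl
    · rintro (h1 | h1)
      · exact h (kv_injective h1).symm
      · exact kv_ne_neg _ _ h1
    · rintro (h1 | h1)
      · exact kv_ne_neg _ _ h1.symm
      · exact h (kv_injective (neg_inj.1 h1)).symm
/-- Off the burst frequencies nothing is ever excited. -/
theorem hit_eq_zero {k : Z3} (hk : ¬ ∃ m : ℕ, k = kv m ∨ k = -kv m) (n : ℕ) : hit k n = 0 :=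
  if_neg fun h => hk ⟨slotMode n, h⟩
/-- **The slot count**: `#{n < N : v₂(n+1) = m} = N/2^m − N/2^{m+1}` (integer division). -/
theorem card_filter_slotMode (m N : ℕ) :
    ((Finset.range N).filter (fun n => slotMode n = m)).card = N / 2 ^ m - N / 2 ^ (m + 1) := by
  have hsub : (Finset.range N).filter (fun n => 2 ^ (m + 1) ∣ n + 1) ⊆
      (Finset.range N).filter (fun n => 2 ^ m ∣ n + 1) := by
    intro n
    simp only [Finset.mem_filter]
    rintro ⟨hn, hd⟩
    exact ⟨hn, (pow_dvd_pow 2 (Nat.le_succ m)).trans hd⟩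
  have heq : (Finset.range N).filter (fun n => slotMode n = m) =
      (Finset.range N).filter (fun n => 2 ^ m ∣ n + 1) \
        (Finset.range N).filter (fun n => 2 ^ (m + 1) ∣ n + 1) := by
    ext n
    simp only [Finset.mem_filter, Finset.mem_sdiff, Finset.mem_range, slotMode]
    have h0 : n + 1 ≠ 0 := Nat.succ_ne_zero n
    rw [padicValNat_dvd_iff_le h0, padicValNat_dvd_iff_le h0]
    omega
  rw [heq, Finset.card_sdiff_of_subset hsub, Nat.card_multiples, Nat.card_multiples]
/-- The count is `N/2^{m+1}` up to an error `< 1`. -/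
theorem abs_card_sub_lt (m N : ℕ) :
    |((((Finset.range N).filter (fun n => slotMode n = m)).card : ℕ) : ℝ) - N / 2 ^ (m + 1)| < 1 := by
  rw [card_filter_slotMode]
  have hq : N / 2 ^ (m + 1) ≤ N / 2 ^ m :=
    Nat.div_le_div_left (Nat.pow_le_pow_right two_pos (Nat.le_succ m)) (pow_pos two_pos m)
  rw [Nat.cast_sub hq]
  have hp : (0 : ℝ) < 2 ^ m := pow_pos two_pos m
  have hp' : (0 : ℝ) < 2 ^ (m + 1) := pow_pos two_pos (m + 1)
  have h1a : ((N / 2 ^ m : ℕ) : ℝ) * 2 ^ m ≤ N := by exact_mod_cast Nat.div_mul_le_self N (2 ^ m)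
  have h1b : (N : ℝ) < (N / 2 ^ m : ℕ) * 2 ^ m + 2 ^ m := by
    exact_mod_cast Nat.lt_div_mul_add (pow_pos two_pos m)
  have h2a : ((N / 2 ^ (m + 1) : ℕ) : ℝ) * 2 ^ (m + 1) ≤ N := by
    exact_mod_cast Nat.div_mul_le_self N (2 ^ (m + 1))
  have h2b : (N : ℝ) < (N / 2 ^ (m + 1) : ℕ) * 2 ^ (m + 1) + 2 ^ (m + 1) := by
    exact_mod_cast Nat.lt_div_mul_add (pow_pos two_pos (m + 1))
  have e1 : ((N / 2 ^ m : ℕ) : ℝ) ≤ N / 2 ^ m := (le_div_iff₀ hp).2 h1a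
  have e2 : (N : ℝ) / 2 ^ m < (N / 2 ^ m : ℕ) + 1 := (div_lt_iff₀ hp).2 (by linarith)
  have e3 : ((N / 2 ^ (m + 1) : ℕ) : ℝ) ≤ N / 2 ^ (m + 1) := (le_div_iff₀ hp').2 h2a
  have e4 : (N : ℝ) / 2 ^ (m + 1) < (N / 2 ^ (m + 1) : ℕ) + 1 := (div_lt_iff₀ hp').2 (by linarith)
  have e5 : (N : ℝ) / 2 ^ m = 2 * (N / 2 ^ (m + 1)) := by
    rw [pow_succ]
    field_simp
  rw [abs_lt]
  constructor <;> linarith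

/-! ## 9. The Cesàro spectrum -/
/-- **Cesàro limit at a burst frequency**: `T⁻¹ ∫₀ᵀ 𝓔(± kv m, t) dt → c₀/(16·2^m)`. -/
theorem tendsto_cesaro_mode (m : ℕ) {k : Z3} (hk : k = kv m ∨ k = -kv m) :
    Tendsto (fun T : ℝ => T⁻¹ * ∫ t in (0 : ℝ)..T, modeEnergy (vel t) k) atTop
      (𝓝 (c0 / (16 * 2 ^ m))) := by
  have hsum : ∀ N : ℕ, ∑ n ∈ Finset.range N, hit k n =
      ((((Finset.range N).filter (fun n => slotMode n = m)).card : ℕ) : ℝ) := fun N => by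
    simp_rw [hit_of_mode m _ hk]
    rw [Finset.sum_boole]
  set L : ℝ := c0 / (16 * 2 ^ m) with hL
  have hp' : (0 : ℝ) < 2 ^ (m + 1) := pow_pos two_pos (m + 1)
  have key : ∀ T : ℝ, 1 ≤ T →
      |T⁻¹ * (∫ t in (0 : ℝ)..T, modeEnergy (vel t) k) - L| ≤ (c0 / 4 + 1 / 8) / T := by
    intro T hT
    have hT0 : 0 < T := by linarith
    set N := ⌊T⌋₊ with hN
    have hNT : (N : ℝ) ≤ T := Nat.floor_le hT0.le
    have hTN : T < N + 1 := Nat.lt_floor_add_one T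
    have hsplit : ∫ t in (0 : ℝ)..T, modeEnergy (vel t) k =
        (∫ t in (0 : ℝ)..N, modeEnergy (vel t) k) + ∫ t in (N : ℝ)..T, modeEnergy (vel t) k :=
      (intervalIntegral.integral_add_adjacent_intervals (intervalIntegrable_upto k N)
        (intervalIntegrable_slot k N hNT hTN.le)).symm
    set I := ∫ t in (N : ℝ)..T, modeEnergy (vel t) k with hI
    have htail : |I| ≤ 1 / 8 := by
      have h := intervalIntegral.norm_integral_le_of_norm_le_const (a := (N : ℝ)) (b := T)
        (C := 1 / 8) (f := fun t => modeEnergy (vel t) k) fun t _ => norm_modeEnergy_vel_le t k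
      rw [Real.norm_eq_abs] at h
      have h' : |T - N| ≤ 1 := by
        rw [abs_of_nonneg (by linarith)]
        linarith
      calc |I| ≤ 1 / 8 * |T - N| := h
        _ ≤ 1 / 8 * 1 := by gcongr
        _ = 1 / 8 := by ring
    set S : ℝ := ((((Finset.range N).filter (fun n => slotMode n = m)).card : ℕ) : ℝ) with hS
    have hcount : |S - N / 2 ^ (m + 1)| < 1 := abs_card_sub_lt m N
    rw [hsplit, integral_upto, hsum]
    have hX : T⁻¹ * (c0 / 8 * S + I) - L = (c0 / 8 * S + I - L * T) / T := by
      field_simp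
    rw [hX, abs_div, abs_of_pos hT0, div_le_div_iff_of_pos_right hT0]
    have hdecomp : c0 / 8 * S + I - L * T =
        c0 / 8 * (S - N / 2 ^ (m + 1)) + c0 / 8 * ((N - T) / 2 ^ (m + 1)) + I := by
      rw [hL]
      field_simp
      ring
    rw [hdecomp]
    have hc8 : 0 < c0 / 8 := by have := c0_pos; positivity
    have hNT' : |((N : ℝ) - T) / 2 ^ (m + 1)| ≤ 1 := by
      rw [abs_div, abs_of_pos hp']
      have h1 : |(N : ℝ) - T| ≤ 1 := by
        rw [abs_sub_comm, abs_of_nonneg (by linarith)]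
        linarith
      have h2 : (1 : ℝ) ≤ 2 ^ (m + 1) := one_le_pow₀ (by norm_num)
      exact (div_le_self (abs_nonneg _) h2).trans h1
    calc |c0 / 8 * (S - N / 2 ^ (m + 1)) + c0 / 8 * ((N - T) / 2 ^ (m + 1)) + I|
        ≤ |c0 / 8 * (S - N / 2 ^ (m + 1))| + |c0 / 8 * ((N - T) / 2 ^ (m + 1))| + |I| :=
          abs_add_three _ _ _
      _ ≤ c0 / 8 * 1 + c0 / 8 * 1 + 1 / 8 := by
          rw [abs_mul, abs_mul, abs_of_pos hc8]
          have hc1 : |S - N / 2 ^ (m + 1)| ≤ 1 := hcount.le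
          gcongr
      _ = c0 / 4 + 1 / 8 := by ring
  have hK : Tendsto (fun T : ℝ => (c0 / 4 + 1 / 8) / T) atTop (𝓝 0) :=
    tendsto_const_nhds.div_atTop tendsto_id
  rw [tendsto_iff_norm_sub_tendsto_zero]
  refine squeeze_zero' (Eventually.of_forall fun T => norm_nonneg _) ?_ hK
  filter_upwards [eventually_ge_atTop (1 : ℝ)] with T hT
  rw [Real.norm_eq_abs]
  exact key T hT
open Classical in
/-- **The Cesàro spectrum of the burst flow**: `Φ(± 2^m e₀) = c₀/(16·2^m)`, zero elsewhere. -/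
noncomputable def Phi (k : Z3) : ℝ :=
  if ∃ m : ℕ, k = kv m ∨ k = -kv m then c0 / (16 * |((k 0 : ℤ) : ℝ)|) else 0
/-- Value of `Φ` at the burst frequencies. -/
theorem Phi_mode (m : ℕ) {k : Z3} (hk : k = kv m ∨ k = -kv m) : Phi k = c0 / (16 * 2 ^ m) := by
  unfold Phi
  rw [if_pos ⟨m, hk⟩]
  have h : |((k 0 : ℤ) : ℝ)| = 2 ^ m := by
    rcases hk with rfl | rfl
    · rw [kv_apply_zero]; push_cast; exact abs_of_pos (pow_pos two_pos m)
    · rw [Pi.neg_apply, kv_apply_zero]; push_cast; rw [abs_neg]; exact abs_of_pos (pow_pos two_pos m)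
  rw [h]
/-- **The witness has a Cesàro spectrum** (`HasCesaroSpectrum vel Φ`): genuine limits at every `k ≠ 0`. -/
theorem hasCesaroSpectrum_vel : HasCesaroSpectrum vel Phi := by
  intro k _
  by_cases h : ∃ m : ℕ, k = kv m ∨ k = -kv m
  · obtain ⟨m, hm⟩ := h
    rw [Phi_mode m hm]
    exact tendsto_cesaro_mode m hm
  · have h0 : (fun T : ℝ => T⁻¹ * ∫ t in (0 : ℝ)..T, modeEnergy (vel t) k) = fun _ => 0 := by
      funext T
      have h1 : (fun t => modeEnergy (vel t) k) = fun _ => 0 := by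
        funext t
        rw [modeEnergy_vel, hit_eq_zero h, mul_zero]
      rw [h1, intervalIntegral.integral_zero, mul_zero]
    unfold Phi
    rw [if_neg h, h0]
    exact tendsto_const_nhds

/-! ## 10. The spectrum violates the K41 upper bound -/
/-- `((2:ℝ)^m)^(-5/3) · 2^m = (2^(-2/3))^m`. -/
theorem rpow_identity (m : ℕ) :
    ((2 : ℝ) ^ m) ^ (-(5 / 3 : ℝ)) * 2 ^ m = ((2 : ℝ) ^ (-(2 / 3 : ℝ))) ^ m := by
  have hp : (0 : ℝ) < 2 ^ m := pow_pos two_pos m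
  have lhs : ((2 : ℝ) ^ m) ^ (-(5 / 3 : ℝ)) * 2 ^ m = ((2 : ℝ) ^ m) ^ (-(2 / 3 : ℝ)) := by
    have h := Real.rpow_add hp (-(5 / 3 : ℝ)) 1
    rw [Real.rpow_one] at h
    rw [← h]
    norm_num
  rw [lhs, Real.rpow_pow_comm (by norm_num : (0 : ℝ) ≤ 2)]
/-- **`Φ` is not K41-bounded above**: `Φ(kv m)·|kv m|^{5/3} = (c₀/16)·2^{2m/3} → ∞`. -/
theorem not_isK41Upper_Phi : ¬ IsK41Upper Phi := by
  rintro ⟨C, k₀, hC⟩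
  set r : ℝ := (2 : ℝ) ^ (-(2 / 3 : ℝ)) with hr
  have hr0 : 0 ≤ r := Real.rpow_nonneg (by norm_num) _
  have hr1 : r < 1 := Real.rpow_lt_one_of_one_lt_of_neg (by norm_num) (by norm_num)
  have hb : ∀ m : ℕ, k₀ ≤ (2 : ℝ) ^ m → c0 / 16 ≤ C * r ^ m := by
    intro m hm
    have h := hC (kv m) (by rwa [klen_kv])
    rw [Phi_mode m (Or.inl rfl), klen_kv] at h
    have hp : (0 : ℝ) < 2 ^ m := pow_pos two_pos m
    have h' := mul_le_mul_of_nonneg_right h hp.le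
    rw [show c0 / (16 * 2 ^ m) * 2 ^ m = c0 / 16 by field_simp, mul_assoc, rpow_identity m] at h'
    exact h'
  have ev1 : ∀ᶠ m : ℕ in atTop, k₀ ≤ (2 : ℝ) ^ m :=
    (tendsto_pow_atTop_atTop_of_one_lt one_lt_two).eventually_ge_atTop k₀
  have hlim : Tendsto (fun m : ℕ => C * r ^ m) atTop (𝓝 0) := by
    have h := (tendsto_pow_atTop_nhds_zero_of_lt_one hr0 hr1).const_mul C
    rwa [mul_zero] at h
  have hc16 : 0 < c0 / 16 := by have := c0_pos; positivity
  have ev2 : ∀ᶠ m : ℕ in atTop, C * r ^ m < c0 / 16 := hlim.eventually (gt_mem_nhds hc16)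
  obtain ⟨m, h1, h2⟩ := (ev1.and ev2).exists
  exact absurd (hb m h1) (not_le.2 h2)

end Summit.NavierStokesRegularity.NavierStokesRegularity.Theorems.LiuYong2026.K41Upper

namespace Summit.NavierStokesRegularity.NavierStokesRegularity.Theorems.LiuYong2026
open Literature.Claims.NS.LiuYong2026
open Literature.Analysis Literature.Analysis.FluidPDE Literature.Analysis.FunctionSpaces

/-- **Headline (γ), C138 `LiuYong2026` charity/erratum column.** The ONE-SIDED forced face
`Literature.Claims.NS.LiuYong2026.Step3_K41_upper` (rev 3 p512649, l.713: every global Leray–Hopf solution of the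
forced problem from the data of Thm 1 with a Cesàro spectrum `Φ` has `Φ(k) ≤ C|k|^{-5/3}` for `|k| ≥ k₀`;
printed locus 引理4.2 p.17 L4–p.18 L5 + 命题4.4 proof p.18 L22–L23 at the grain of 引理H.1 p.57 L13) is FALSE in the
print's forced class: witness the recurring 2-adic burst flow at `ν = 1` — smooth force on `[0,∞) × 𝕋³`, rest
datum, an exact classical hence global Leray–Hopf solution, with GENUINE Cesàro limits
`Φ(±2^m e₀) = c₀/(16·2^m)` (zero elsewhere), so `Φ(k)|k|^{5/3} = (c₀/16)·2^{2m/3}` is unbounded along `k = 2^m e₀`.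
first failing step = `Literature.Claims.NS.LiuYong2026.Step3_K41_upper` (print p.18), class = false lemma
(countermodel). The adjudicated token of row #119 stays `Step3_K41` / `not_Step3_K41` (p511629); this theorem is
the records-grade companion RULED (γ) 07:47:20Z, not a re-key. -/
theorem not_Step3_K41_upper : ¬ Step3_K41_upper := fun h =>
  K41Upper.not_isK41Upper_Phi (h 1 _ _ (K41Upper.isData_vel one_pos) _ _
    (K41Upper.isGlobalLerayHopf_vel 1) K41Upper.hasCesaroSpectrum_vel)

end Summit.NavierStokesRegularity.NavierStokesRegularity.Theorems.LiuYong2026
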